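import Summits.QuantumFields.BalabanUV.Beta.FP.PeriodisedLamGaugeLeg
import Summits.QuantumFields.BalabanUV.Beta.FP.PeriodisedWardOrderTwoWilson
import Summits.QuantumFields.BalabanUV.Beta.FP.TorusCompositeFP

/-!
# `BalabanUV.Beta.FP.PeriodisedWardOrderOneTower` — road «FP» for binder row D1, ROUTE T under RULING R-D1-g52-1 (β1) ∕ the OWNER d1-p3's W-FP-32-3
# (SPEC-45 §A last row: «the graded WARD rows `a1 a2` of #21-Sym ∀ direction at the SYM bricks … your (α′) per-word lineage is the rooted precedent»):
# **THE PER-WORD CLOSED FORMS OF THE TOWER DOOR's WARD ROWS `a1` (Wilson + Λ members) AND `a2` (Wilson member), AT EVERY DEPTH** — the twins of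
# `PeriodisedFormGaugeLeg.torus_a1_wilson`, `PeriodisedLamGaugeLegDoor.torus_a1_lam`, `PeriodisedWardOrderTwoWilson.torus_a2_wilson` (level 0, generators
# `fromCols D₂ D₁`) for the COMPOSITE tower's generator matrix `towerGen Lc M′ rs n` (leaf-06 `TorusCompositeObjects` §6: the gauge modes of EVERY level as fields
# of the finest torus `towerTorus Lc M′ n`, columns `NParam`) and the generator jets `W₁ W₂` of #21 ∕ #21-Sym's `hW₁ hW₂` (leaf-06 `TorusCompositeFP.evalN`),
# from ONE generic letter

WHY.  #21-Sym `NestedStepLawTorusCompositeOneShotTopSym` (and #41c-Sym ∕ #41d-Sym ∕ #42a-Sym above it) DISPLAY, for every direction `h`, the graded Ward rows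
`a1 : H₁ W₀ + H₀ W₁ = 𝔔₀ᵀ Y₁`, `a2 : H₂ W₀ + 2•(H₁ W₁) + H₀ W₂ = −2•(𝔔₁ᵀ Y₁) + 𝔔₀ᵀ Y₂` with `W₀ = towerGen Lc M′ rs (n+1)`, `W₁ W₂` by `evalN`, `H₀` the
finest form block, `H₁ H₂` the form's graded jets along `h`.  At level 0 this lineage computes the Wilson and Λ members against the generators in closed form
and `PeriodisedWardOrderOneCompanion` closes `a1` under the direction's KKT rows.  THIS FILE lifts the per-word closed forms to the tower ONCE: every column of
`towerGen` is the finest-lattice GRADIENT of an `M·ℤ^{d+1}`-periodic potential — the point evaluation `ψ_e := evalN Lc M rs n (fun z => z) · e` of the nested mode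
`e` (fine modes `tdelta`, block-constant modes `tdelta M (quo (bigRatio Lc k) ·) t`) —, so ANY right-slot pure-gauge law stated for an arbitrary periodic potential
(this lineage's `…_mul_grad_periodic` letters) holds against `towerGen` with the potential `ψ_e` (the recursion of leaf-06 ∕ the OWNER's
`NestedStepLawTorusCompositeOneShot.sum_perZ_bhKStepAt_ff_mul_towerGen` for `a0`, made generic):
* §0 `evalN_apply_eq` (`rfl` recursion); §1 **`sum_perZ_mul_towerGen_of_grad_law`** — GENERIC: a kernel `K`, a left leg `(x, α)`, a closed form `F φ` valid for
  every `towerTorus Lc M n`-periodic `φ` ⟹ `Σ_{(y,β)} perZ T K x y (inl α) (inl β) · towerGen Lc M rs n (y,β) e = F ψ_e`;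
* §2 `sum_perZ_dper_wilsonA_mul_towerGen` + **`torus_a1_wilson_tower`**: `((−2c) • Σ_b h_b • (perF T (dper T (wilsonA d b)))|ff) * W₀ + H₀ * W₁ = −(c∕2) • of (v e ↦
  (H₀ *ᵥ h) v · (ψ_e(v.1) + ψ_e(v.1 + e_{v.2})))` at #21's `hW₀ hW₁` VERBATIM and `H₀ = (perF T (bhKStepAt d ρ L 0))|ff` — LEVEL 0, rooted spelling, any root ∕
  window (the (0.4)-symmetrised `bhKStepSh d Lc (Dsh Lc) 0` has the same ff block: #21-Sym §0 ∕ `NestedStepLawTorusTransportedRowsGradedSym.perF_bhKStepSh_Dsh_ff_eq_perF_bhKStepAt`);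
* §3 `sum_perZ_dper_SLam_mul_towerGen` + **`torus_a1_lam_tower`**: the Λ-family of the FIRST step above the finest torus (`T = L·M₁`, box root `toSite r`,
  coefficients `c` GENERIC, summable along the `M₁`-copies, weight `w`; `L = Lc`, `r = ctrOff`; at level 0 the record's `c` is `lamCoeffOf KInv Lc`):
  `(Σ_b h_b • (w • Λ_b|ff)) * W₀ = w • of (v e ↦ Σ_b h_b · Σ_μ Σ'_y c^per_b(μ,y) · ((ψ_e(v.1) + ψ_e(v.1+e_{v.2}) − ψ_e(L•y+ρ) − ψ_e(L•y+ρ+L•e_μ)) · q¹_{(μ,y)}(v) ∕ 2))`;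
* §4 `sum_perZ_dper_wilsonT2per_mul_towerGen` + **`torus_a2_wilson_tower`** (`hW₂`, an2's bi-family `hW`, `2 ≤ N`): `H₂ʷ * W₀ + 2 • (H₁ʷ * W₁) + H₀ * W₂ =
  c² • of (v e ↦ h v · (H₀ *ᵥ h) v · ψ_e(v.1 + e_{v.2}))` by `PeriodisedWardOrderTwoWilson.a2_row_algebra` BY NAME.
So the tower's Ward rows have, member by member, the SAME closed forms as at level 0 with the column potentials replaced by `ψ_e`; what closes them
(`= 𝔔₀ᵀ Y₁`, `= −2•(𝔔₁ᵀ Y₁) + 𝔔₀ᵀ Y₂`) is the KKT row of the nested column `h = hv v` and the companion ∕ multiplier readings storey by storey — the road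
OWNER's ∕ the row OWNER's words on the depth-`n` tables (SPEC-45 §E J-RISK-3).  [folklore] finite sums BY NAME over OUR typed objects; no `def`, no `def … : Prop`,
nothing cited, 0 sorry; 0 estimates.  Discharges NO row of the door by itself.

HONEST DEPENDENCY (page 1, mandatory): continuum YM on T⁴ ⇐ BetaPertH ∧ nine spine estimates (0/9 proved); BetaPertH ⇐ (D1) ∧ (D4) ∧ CAP+tail;
G-an2-4 gates asym, D1 and NE2/3/4.  HONEST FRAMING (cell contract, verbatim): «discharging `BetaPertH` makes Bałaban's UV stability UNCONDITIONAL —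
a real constructive-QFT result; it is NOT the continuum limit and NOT the Clay problem.»  ABSOLUTE RULE (cell charter, verbatim): «No internally-minted
statement may enter as a cited fact. Every hypothesis is either kernel-proved in this package or a verbatim quotation of a PUBLISHED theorem with page
reference. The manuscript(s) under audit are NOT citable for their own disputed steps — they are the thing under adjudication; programme-internal
(2001/route/tribunal) claims are never citable.»  Nothing of Bałaban's ∕ the dictionary's asserted; 0∕4 row-D1 binders (hW, hR, D1Tel, D1Rep); ROOT M‴ p325680
untouched; NOT (C1), NOT (T-ID), NOT SDF, NOT D1, NEVER «G-an2-4 closed», NOT BetaPertH, NOT continuum, NOT Clay.  «not in print; our bookkeeping».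
Unit `b2b-balaban-beta-d1-formalise-leaf-05` (gen 43), 2026-08-24; no existing file touched.
-/

noncomputable section

namespace Summit.QuantumFields.BalabanUV.Beta.FP.PeriodisedWardOrderOneTower

open scoped BigOperators Matrix
open Finset Matrix
open Literature.MathematicalPhysics.QuantumFieldTheory.Balaban1983to89
open Literature.MathematicalPhysics.QuantumFieldTheory.Balaban1983to89.Beta
open B4TorusKernel.MultiPeriod (translate)
open B5Prop11Plancherel (fine)
open B6Lemma24Torus (pbox mem_pbox)
open ExpKernelCalculus (MKer)
open AffineAveraging (Site box toSite unitVec)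
open OneStepResolventKernel (Fib)
open StepJetData (wilsonA)
open InterLevelTransport (SLam)
open Literature.MathematicalPhysics.QuantumFieldTheory.LatticeForm (quo)
open Summit.QuantumFields.BalabanUV.Beta.SymAveragingHessianCounts (symHessFFAt symLinKerAt)
open Summit.QuantumFields.BalabanUV.Beta.BorderedHessian (bhKStepAt)
open Summit.QuantumFields.BalabanUV.Beta.FP.KernelPeriodisationFib (Idx perF perF_apply perZ perZ_apply)
open Summit.QuantumFields.BalabanUV.Beta.FP.KernelPeriodisationFibLoc (dper)
open Summit.QuantumFields.BalabanUV.Beta.FP.TorusGaugeCovariance (tdelta tdelta_translate tgrad tgrad_inl)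
open Summit.QuantumFields.BalabanUV.Beta.FP.TorusGaugeCovarianceCoarse (tgradBlock tgradBlock_inl tdelta_quo_congr)
open Summit.QuantumFields.BalabanUV.Beta.FP.TorusCombRows (Res)
open Summit.QuantumFields.BalabanUV.Beta.FP.TorusCompositeObjects (towerTorus towerTorus_apply NParam towerGen bigRatio bigRatio_pos bigRatio_eq_pow pboxCongr
  pboxCongr_coe)
open Summit.QuantumFields.BalabanUV.Beta.FP.TorusCompositeFP (evalN)
open Summit.QuantumFields.BalabanUV.Beta.FP.PeriodisedFormGaugeLeg (sum_perZ_dper_wilsonA_mul_grad_periodic)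
open Summit.QuantumFields.BalabanUV.Beta.FP.PeriodisedLamGaugeLeg (sum_perZ_dper_SLam_symHessFFAt_mul_grad_periodic)
open WilsonBiStencil (wilsonW₂)
open WilsonVertex2Sym (wsym22)
open Summit.QuantumFields.BalabanUV.Beta.FP.PeriodisedFormGaugeLegTwo (sum_perZ_dper_wilsonT2per_mul_grad_periodic)
open Summit.QuantumFields.BalabanUV.Beta.FP.PeriodisedWardOrderTwoWilson (a2_row_algebra)

variable {d : ℕ} (Lc : ℕ) [NeZero Lc]

/-! ## §0 The point-evaluation matrix reads the mode's potential at the point (a `rfl` recursion) -/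

omit [NeZero Lc] in
/-- [folklore] `evalN` through a point map `y` IS the mode's potential `ψ_e := evalN Lc M rs n (fun z => z) · e` read at `y b` (`rfl` down `evalN_zero ∕ _succ`). -/
theorem evalN_apply_eq {β : Type*} (y : β → Site (d + 1)) (b : β) :
    ∀ (n : ℕ) (M : Fin (d + 1) → ℕ) (rs : ℕ → (Fin (d + 1) → ℕ)) (e : NParam Lc M rs n),
      evalN Lc M rs n y b e = evalN Lc M rs n (fun z : Site (d + 1) => z) (y b) e
  | 0, _, _, _ => rfl
  | _ + 1, _, _, Sum.inl _ => rfl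
  | n + 1, M, rs, Sum.inr e => evalN_apply_eq y b n (fine Lc M) (fun k => rs (k + 1)) e

/-! ## §1 GENERIC: a right-slot pure-gauge law valid for every periodic potential holds against every column of the tower generator matrix -/

/-- **[folklore] `sum_perZ_mul_towerGen_of_grad_law` — THE TOWER's GENERATORS ARE GRADIENTS OF PERIODIC POTENTIALS.**  On the finest torus `T = towerTorus Lc M n`
of leaf-06's tower (top `M`, in-block roots `rs`, depth `n`): if a lattice kernel `K` obeys, for the left leg `(x, α)` and EVERY `T·ℤ^{d+1}`-periodic potential `φ`,
the right-slot law `Σ_{(y,β)} perZ T K x y (inl α) (inl β) · (φ(y + e_β) − φ y) = F φ`, then against every nested mode `e : NParam Lc M rs n`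
`Σ_{(y,β)} perZ T K x y (inl α) (inl β) · towerGen Lc M rs n (y,β) e = F ψ_e`, `ψ_e := (evalN Lc M rs n (fun z => z) · e)`.  Recursion of `towerGen` ∕ `evalN` (both `rfl`):
depth `0` = the torus's own fine modes (`tdelta M · e.1`); depth `n+1`: lower modes = the statement at `fine Lc M` (SAME finest torus, `rfl`), top modes = the
block potential `z ↦ [quo (bigRatio Lc n) z ≡ t]` (`tgradBlock_inl`, `pboxCongr_coe`; periodic by `tdelta_quo_congr`, `towerTorus_apply`, `bigRatio_eq_pow`). -/
theorem sum_perZ_mul_towerGen_of_grad_law (x : Site (d + 1)) (α : Fin (d + 1)) :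
    ∀ (n : ℕ) (M : Fin (d + 1) → ℕ) [∀ μ, NeZero (M μ)] (rs : ℕ → (Fin (d + 1) → ℕ)) (K : MKer (d + 1) (Fib d)) (F : (Site (d + 1) → ℝ) → ℝ)
      (_hK : ∀ φ : Site (d + 1) → ℝ, (∀ z m : Site (d + 1), φ (translate (towerTorus Lc M n) z m) = φ z) →
        ∑ y : ↥(pbox (towerTorus Lc M n)), ∑ β : Fin (d + 1),
            perZ (towerTorus Lc M n) K x (y : Site (d + 1)) (Sum.inl α) (Sum.inl β) * (φ ((y : Site (d + 1)) + unitVec β) - φ y) = F φ)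
      (e : NParam Lc M rs n),
      ∑ y : ↥(pbox (towerTorus Lc M n)), ∑ β : Fin (d + 1),
          perZ (towerTorus Lc M n) K x (y : Site (d + 1)) (Sum.inl α) (Sum.inl β) * towerGen Lc M rs n (y, β) e
        = F (fun z : Site (d + 1) => evalN Lc M rs n (fun z : Site (d + 1) => z) z e)
  | 0, M, _, _, _, _, hK, e => hK (fun z : Site (d + 1) => tdelta M z e.1) (fun z m => tdelta_translate M z m e.1)
  | n + 1, M, _, rs, K, F, hK, Sum.inr e => sum_perZ_mul_towerGen_of_grad_law x α n (fine Lc M) (fun k => rs (k + 1)) K F hK e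
  | n + 1, M, _, rs, _, _, hK, Sum.inl t => by
    haveI : NeZero (bigRatio Lc n) := ⟨(bigRatio_pos Lc (Nat.pos_of_ne_zero (NeZero.ne Lc)) n).ne'⟩
    refine hK (fun z : Site (d + 1) => tdelta M (quo (bigRatio Lc n) z) t.1) (fun z m => ?_)
    refine tdelta_quo_congr M (bigRatio Lc n) (fun i => ⟨m i, ?_⟩) t.1
    rw [B4TorusKernel.MultiPeriod.translate_apply, towerTorus_apply, bigRatio_eq_pow]
    push_cast
    ring

/-! ## §2 THE WILSON MEMBER of `a1`: the periodised cubic Wilson family against the tower's generators; the closed form -/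

/-- **[folklore] `sum_perZ_dper_wilsonA_mul_towerGen`** — §1 at `PeriodisedFormGaugeLeg.sum_perZ_dper_wilsonA_mul_grad_periodic`: for the index bond `(κ′, u)`,
the left leg `(x, α)` and any nested mode `e`,
`Σ_{(y,β)} perZ T (dper T (wilsonA d κ′ u)) x y (inl α) (inl β) · towerGen Lc M rs n (y,β) e = −(½ · (ψ_e(u + e_κ′) − (ψ_e(x) + ψ_e(x + e_α))∕2) · perZ T (bhKStepAt d ρ L 0) x u (inl α) (inl κ′))`
(the mode's potential at the END of the index bond and at the two ENDPOINTS of the left leg, against the level-0 form block; any root `ρ`, any window `L`). -/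
theorem sum_perZ_dper_wilsonA_mul_towerGen (ρ : Site (d + 1)) (L : ℕ) [NeZero L] (n : ℕ) (M : Fin (d + 1) → ℕ) [∀ μ, NeZero (M μ)]
    (rs : ℕ → (Fin (d + 1) → ℕ)) (κ' : Fin (d + 1)) (u x : Site (d + 1)) (α : Fin (d + 1)) (e : NParam Lc M rs n) :
    ∑ y : ↥(pbox (towerTorus Lc M n)), ∑ β : Fin (d + 1),
        perZ (towerTorus Lc M n) (dper (towerTorus Lc M n) (wilsonA d κ' u)) x (y : Site (d + 1)) (Sum.inl α) (Sum.inl β) * towerGen Lc M rs n (y, β) e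
      = -((1 / 2 : ℝ) * (evalN Lc M rs n (fun z : Site (d + 1) => z) (u + unitVec κ') e
            - (evalN Lc M rs n (fun z : Site (d + 1) => z) x e + evalN Lc M rs n (fun z : Site (d + 1) => z) (x + unitVec α) e) / 2)
          * perZ (towerTorus Lc M n) (bhKStepAt d ρ L 0) x u (Sum.inl α) (Sum.inl κ')) :=
  sum_perZ_mul_towerGen_of_grad_law Lc x α n M rs (dper (towerTorus Lc M n) (wilsonA d κ' u))
    (fun φ : Site (d + 1) → ℝ => -((1 / 2 : ℝ) * (φ (u + unitVec κ') - (φ x + φ (x + unitVec α)) / 2)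
      * perZ (towerTorus Lc M n) (bhKStepAt d ρ L 0) x u (Sum.inl α) (Sum.inl κ')))
    (fun _ hφ => sum_perZ_dper_wilsonA_mul_grad_periodic (towerTorus Lc M n) ρ L κ' u x α hφ) e

/-- **[folklore] `torus_a1_wilson_tower` — THE WILSON SECTOR OF THE TOWER's `a1` ROW IN CLOSED FORM**: on `T = towerTorus Lc M′ n`, for any bond weight `h`,
any `c`, `((−2c) • Σ_b h b • (perF T (dper T (wilsonA d b.2 b.1)))|ff) * W₀ + H₀ * W₁ = −(c∕2) • of (v e ↦ (H₀ *ᵥ h) v · (ψ_e(v.1) + ψ_e(v.1 + e_{v.2})))`,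
`ψ_e := (evalN Lc M′ rs n (fun z => z) · e)`, at `hW₀ : W₀ = towerGen Lc M′ rs n`, `hW₁ : W₁ = of (b e ↦ −(c · h b · evalN Lc M′ rs n (·.1 + e_{·.2}) b e))`
(#21's shape at depth `n`), `hH₀ : H₀ = (perF T (bhKStepAt d ρ L 0))|ff` — the diagonal reading of the linearised-KKT residual `H₀ h`; `torus_a1_wilson` at every storey. -/
theorem torus_a1_wilson_tower (M' : Fin (d + 1) → ℕ) [∀ μ, NeZero (M' μ)] (rs : ℕ → (Fin (d + 1) → ℕ)) (n : ℕ) (ρ : Site (d + 1)) (L : ℕ) [NeZero L]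
    (c : ℝ) (h : ↥(pbox (towerTorus Lc M' n)) × Fin (d + 1) → ℝ)
    {H₀ : Matrix (↥(pbox (towerTorus Lc M' n)) × Fin (d + 1)) (↥(pbox (towerTorus Lc M' n)) × Fin (d + 1)) ℝ}
    (hH₀ : H₀ = (perF (towerTorus Lc M' n) (bhKStepAt d ρ L 0)).submatrix
        (fun b : ↥(pbox (towerTorus Lc M' n)) × Fin (d + 1) => ((b.1, Sum.inl b.2) : Idx (towerTorus Lc M' n) (Fib d)))
        (fun b : ↥(pbox (towerTorus Lc M' n)) × Fin (d + 1) => ((b.1, Sum.inl b.2) : Idx (towerTorus Lc M' n) (Fib d))))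
    {W₀ : Matrix (↥(pbox (towerTorus Lc M' n)) × Fin (d + 1)) (NParam Lc M' rs n) ℝ} (hW₀ : W₀ = towerGen Lc M' rs n)
    {W₁ : Matrix (↥(pbox (towerTorus Lc M' n)) × Fin (d + 1)) (NParam Lc M' rs n) ℝ}
    (hW₁ : W₁ = Matrix.of fun (b : (↥(pbox (towerTorus Lc M' n)) × Fin (d + 1))) (e : NParam Lc M' rs n) =>
        -(c * h b * evalN Lc M' rs n (fun b' : (↥(pbox (towerTorus Lc M' n)) × Fin (d + 1)) => (b'.1 : Site (d + 1)) + unitVec b'.2) b e)) :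
    ((-2 * c) • ∑ b : ↥(pbox (towerTorus Lc M' n)) × Fin (d + 1), h b •
          (perF (towerTorus Lc M' n) (dper (towerTorus Lc M' n) (wilsonA d b.2 (b.1 : Site (d + 1))))).submatrix
            (fun b : ↥(pbox (towerTorus Lc M' n)) × Fin (d + 1) => ((b.1, Sum.inl b.2) : Idx (towerTorus Lc M' n) (Fib d)))
            (fun b : ↥(pbox (towerTorus Lc M' n)) × Fin (d + 1) => ((b.1, Sum.inl b.2) : Idx (towerTorus Lc M' n) (Fib d))))
        * W₀ + H₀ * W₁
      = -(c / 2) • Matrix.of (fun (v : ↥(pbox (towerTorus Lc M' n)) × Fin (d + 1)) (e : NParam Lc M' rs n) =>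
          H₀.mulVec h v * (evalN Lc M' rs n (fun z : Site (d + 1) => z) (v.1 : Site (d + 1)) e
            + evalN Lc M' rs n (fun z : Site (d + 1) => z) ((v.1 : Site (d + 1)) + unitVec v.2) e)) := by
  -- entries of the three ingredients
  have hH0 : ∀ v b : ↥(pbox (towerTorus Lc M' n)) × Fin (d + 1),
      H₀ v b = perZ (towerTorus Lc M' n) (bhKStepAt d ρ L 0) (v.1 : Site (d + 1)) (b.1 : Site (d + 1)) (Sum.inl v.2) (Sum.inl b.2) := fun v b => by
    rw [hH₀]; rfl
  have hW1 : ∀ (b' : ↥(pbox (towerTorus Lc M' n)) × Fin (d + 1)) (e : NParam Lc M' rs n),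
      W₁ b' e = h b' * (-c * evalN Lc M' rs n (fun z : Site (d + 1) => z) ((b'.1 : Site (d + 1)) + unitVec b'.2) e) := fun b' e => by
    rw [hW₁, Matrix.of_apply, evalN_apply_eq Lc (fun b' : (↥(pbox (towerTorus Lc M' n)) × Fin (d + 1)) => (b'.1 : Site (d + 1)) + unitVec b'.2) b' n M' rs e]
    ring
  have hWD : ∀ (b v : ↥(pbox (towerTorus Lc M' n)) × Fin (d + 1)) (e : NParam Lc M' rs n),
      ((perF (towerTorus Lc M' n) (dper (towerTorus Lc M' n) (wilsonA d b.2 (b.1 : Site (d + 1))))).submatrix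
            (fun b : ↥(pbox (towerTorus Lc M' n)) × Fin (d + 1) => ((b.1, Sum.inl b.2) : Idx (towerTorus Lc M' n) (Fib d)))
            (fun b : ↥(pbox (towerTorus Lc M' n)) × Fin (d + 1) => ((b.1, Sum.inl b.2) : Idx (towerTorus Lc M' n) (Fib d))) * W₀) v e
        = -((1 / 2 : ℝ) * (evalN Lc M' rs n (fun z : Site (d + 1) => z) ((b.1 : Site (d + 1)) + unitVec b.2) e
              - (evalN Lc M' rs n (fun z : Site (d + 1) => z) (v.1 : Site (d + 1)) e
                  + evalN Lc M' rs n (fun z : Site (d + 1) => z) ((v.1 : Site (d + 1)) + unitVec v.2) e) / 2)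
            * perZ (towerTorus Lc M' n) (bhKStepAt d ρ L 0) (v.1 : Site (d + 1)) (b.1 : Site (d + 1)) (Sum.inl v.2) (Sum.inl b.2)) := fun b v e => by
    rw [hW₀, Matrix.mul_apply, Fintype.sum_prod_type]
    simp only [Matrix.submatrix_apply, perF_apply]
    exact sum_perZ_dper_wilsonA_mul_towerGen Lc ρ L n M' rs b.2 (b.1 : Site (d + 1)) (v.1 : Site (d + 1)) v.2 e
  ext v e
  rw [Matrix.add_apply, Matrix.smul_apply, Matrix.of_apply, Matrix.smul_mul, Matrix.sum_mul, Matrix.smul_apply, Matrix.sum_apply, Matrix.mul_apply]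
  simp only [hW1, Matrix.mulVec, dotProduct, hH0, Matrix.smul_mul, Matrix.smul_apply, hWD, smul_eq_mul]
  rw [Finset.mul_sum, Finset.sum_mul, Finset.mul_sum, ← Finset.sum_add_distrib]
  refine Finset.sum_congr rfl fun b _ => ?_
  ring

/-! ## §3 THE Λ MEMBER of `a1`: the periodised Λ-stencil of the first step above the finest torus against the tower's generators; the closed form -/

/-- **[folklore] `sum_perZ_dper_SLam_mul_towerGen`** — §1 at `PeriodisedLamGaugeLeg.sum_perZ_dper_SLam_symHessFFAt_mul_grad_periodic`: the finest torus
`T = towerTorus Lc M n` is `L·M₁` (`hM`), box root `toSite r` (`r ∈ box (d+1) L`), the Λ-stencil `SΛ κ′ u = SLam N c (symHessFFAt (toSite r) L) κ′ u` with ANY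
coefficient family `c` summable along the `M₁`-period copies; then for any nested mode `e`,
`Σ_{(w,β)} perZ T (dper T (SΛ κ′ u)) x w (inl α) (inl β) · towerGen Lc M rs n (w,β) e
  = Σ_μ Σ'_y c^per μ y κ′ u · (ψ_e x + ψ_e(x + e_α) − ψ_e(L•y + ρ) − ψ_e(L•y + ρ + L•e_μ)) · q¹_{(μ,y)}(α, x) ∕ 2`. -/
theorem sum_perZ_dper_SLam_mul_towerGen {N : ℕ} [NeZero N] {M₁ : Fin (d + 1) → ℕ} {L : ℕ} (n : ℕ) (M : Fin (d + 1) → ℕ) [∀ μ, NeZero (M μ)]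
    (rs : ℕ → (Fin (d + 1) → ℕ)) (hM : ∀ i, towerTorus Lc M n i = L * M₁ i) (hL : 1 ≤ L) {r : Fin (d + 1) → ℕ} (hr : r ∈ box (d + 1) L)
    (c : Fin (d + 1) → Site (d + 1) → Fin (d + 1) → Site (d + 1) → ℝ) (κ' : Fin (d + 1)) (u : Site (d + 1))
    (hc : ∀ μ y, Summable fun m : Site (d + 1) => c μ (translate M₁ y m) κ' u) (x : Site (d + 1)) (α : Fin (d + 1)) (e : NParam Lc M rs n) :
    ∑ w : ↥(pbox (towerTorus Lc M n)), ∑ β : Fin (d + 1),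
        perZ (towerTorus Lc M n) (dper (towerTorus Lc M n) (SLam N c (fun μ y => symHessFFAt (toSite r) L μ y) κ' u)) x (w : Site (d + 1))
            (Sum.inl α) (Sum.inl β) * towerGen Lc M rs n (w, β) e
      = ∑ μ : Fin (d + 1), ∑' y : Site (d + 1), (∑' m : Site (d + 1), c μ (translate M₁ y m) κ' u) *
          ((evalN Lc M rs n (fun z : Site (d + 1) => z) x e + evalN Lc M rs n (fun z : Site (d + 1) => z) (x + unitVec α) e
              - evalN Lc M rs n (fun z : Site (d + 1) => z) ((L : ℤ) • y + toSite r) e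
              - evalN Lc M rs n (fun z : Site (d + 1) => z) ((L : ℤ) • y + toSite r + (L : ℤ) • unitVec μ) e)
            * symLinKerAt (toSite r) L μ y (α, x) / 2) :=
  sum_perZ_mul_towerGen_of_grad_law Lc x α n M rs (dper (towerTorus Lc M n) (SLam N c (fun μ y => symHessFFAt (toSite r) L μ y) κ' u))
    (fun φ : Site (d + 1) → ℝ => ∑ μ : Fin (d + 1), ∑' y : Site (d + 1), (∑' m : Site (d + 1), c μ (translate M₁ y m) κ' u) *
      ((φ x + φ (x + unitVec α) - φ ((L : ℤ) • y + toSite r) - φ ((L : ℤ) • y + toSite r + (L : ℤ) • unitVec μ))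
        * symLinKerAt (toSite r) L μ y (α, x) / 2))
    (fun _ hφ => sum_perZ_dper_SLam_symHessFFAt_mul_grad_periodic (towerTorus Lc M n) hM hL hr c κ' u hc x α hφ) e

/-- **[folklore] `torus_a1_lam_tower` — THE Λ SECTOR OF THE TOWER's `a1` ROW IN CLOSED FORM**: on `T = towerTorus Lc M′ n = L·M₁`, box root `toSite r`,
for any bond weight `h`, any `w`, any coefficient family summable along the `M₁`-period copies,
`(Σ_b h b • (w • Λ_b|ff)) * W₀ = w • of (v e ↦ Σ_b h b · Σ_μ Σ'_y c^per_b(μ,y) · ((ψ_e(v.1) + ψ_e(v.1+e_{v.2}) − ψ_e(L•y+ρ) − ψ_e(L•y+ρ+L•e_μ)) · q¹_{(μ,y)}(v) ∕ 2))`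
at `hW₀ : W₀ = towerGen Lc M′ rs n` — `torus_a1_lam` at every storey (level 0: `M₁ = M′`, `L = Lc`, the columns `fromCols D₂ D₁`). -/
theorem torus_a1_lam_tower {N : ℕ} [NeZero N] (M' : Fin (d + 1) → ℕ) [∀ μ, NeZero (M' μ)] (rs : ℕ → (Fin (d + 1) → ℕ)) (n : ℕ)
    {M₁ : Fin (d + 1) → ℕ} {L : ℕ} (hM : ∀ i, towerTorus Lc M' n i = L * M₁ i) (hL : 1 ≤ L) {r : Fin (d + 1) → ℕ} (hr : r ∈ box (d + 1) L) (w : ℝ)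
    (h : ↥(pbox (towerTorus Lc M' n)) × Fin (d + 1) → ℝ) (c : Fin (d + 1) → Site (d + 1) → Fin (d + 1) → Site (d + 1) → ℝ)
    (hc : ∀ κ' u μ y, Summable fun m : Site (d + 1) => c μ (translate M₁ y m) κ' u)
    {W₀ : Matrix (↥(pbox (towerTorus Lc M' n)) × Fin (d + 1)) (NParam Lc M' rs n) ℝ} (hW₀ : W₀ = towerGen Lc M' rs n) :
    (∑ b : ↥(pbox (towerTorus Lc M' n)) × Fin (d + 1), h b •
          (w • (perF (towerTorus Lc M' n) (dper (towerTorus Lc M' n)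
              (SLam N c (fun μ y => symHessFFAt (toSite r) L μ y) b.2 (b.1 : Site (d + 1))))).submatrix
            (fun b : ↥(pbox (towerTorus Lc M' n)) × Fin (d + 1) => ((b.1, Sum.inl b.2) : Idx (towerTorus Lc M' n) (Fib d)))
            (fun b : ↥(pbox (towerTorus Lc M' n)) × Fin (d + 1) => ((b.1, Sum.inl b.2) : Idx (towerTorus Lc M' n) (Fib d)))))
        * W₀
      = w • Matrix.of (fun (v : ↥(pbox (towerTorus Lc M' n)) × Fin (d + 1)) (e : NParam Lc M' rs n) =>
          ∑ b : ↥(pbox (towerTorus Lc M' n)) × Fin (d + 1), h b *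
            ∑ μ : Fin (d + 1), ∑' y : Site (d + 1), (∑' m : Site (d + 1), c μ (translate M₁ y m) b.2 (b.1 : Site (d + 1))) *
              ((evalN Lc M' rs n (fun z : Site (d + 1) => z) (v.1 : Site (d + 1)) e
                  + evalN Lc M' rs n (fun z : Site (d + 1) => z) ((v.1 : Site (d + 1)) + unitVec v.2) e
                  - evalN Lc M' rs n (fun z : Site (d + 1) => z) ((L : ℤ) • y + toSite r) e
                  - evalN Lc M' rs n (fun z : Site (d + 1) => z) ((L : ℤ) • y + toSite r + (L : ℤ) • unitVec μ) e)
                * symLinKerAt (toSite r) L μ y (v.2, (v.1 : Site (d + 1))) / 2)) := by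
  have hLD : ∀ (b v : ↥(pbox (towerTorus Lc M' n)) × Fin (d + 1)) (e : NParam Lc M' rs n),
      ((perF (towerTorus Lc M' n) (dper (towerTorus Lc M' n) (SLam N c (fun μ y => symHessFFAt (toSite r) L μ y) b.2 (b.1 : Site (d + 1))))).submatrix
            (fun b : ↥(pbox (towerTorus Lc M' n)) × Fin (d + 1) => ((b.1, Sum.inl b.2) : Idx (towerTorus Lc M' n) (Fib d)))
            (fun b : ↥(pbox (towerTorus Lc M' n)) × Fin (d + 1) => ((b.1, Sum.inl b.2) : Idx (towerTorus Lc M' n) (Fib d))) * W₀) v e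
        = ∑ μ : Fin (d + 1), ∑' y : Site (d + 1), (∑' m : Site (d + 1), c μ (translate M₁ y m) b.2 (b.1 : Site (d + 1))) *
          ((evalN Lc M' rs n (fun z : Site (d + 1) => z) (v.1 : Site (d + 1)) e
              + evalN Lc M' rs n (fun z : Site (d + 1) => z) ((v.1 : Site (d + 1)) + unitVec v.2) e
              - evalN Lc M' rs n (fun z : Site (d + 1) => z) ((L : ℤ) • y + toSite r) e
              - evalN Lc M' rs n (fun z : Site (d + 1) => z) ((L : ℤ) • y + toSite r + (L : ℤ) • unitVec μ) e)
            * symLinKerAt (toSite r) L μ y (v.2, (v.1 : Site (d + 1))) / 2) := fun b v e => by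
    rw [hW₀, Matrix.mul_apply, Fintype.sum_prod_type]
    simp only [Matrix.submatrix_apply, perF_apply]
    exact sum_perZ_dper_SLam_mul_towerGen Lc n M' rs hM hL hr c b.2 (b.1 : Site (d + 1)) (hc b.2 _) (v.1 : Site (d + 1)) v.2 e
  ext v e
  rw [Matrix.sum_mul, Matrix.sum_apply, Matrix.smul_apply, Matrix.of_apply, smul_eq_mul, Finset.mul_sum]
  refine Finset.sum_congr rfl fun b _ => ?_
  rw [Matrix.smul_mul, Matrix.smul_apply, Matrix.smul_mul, Matrix.smul_apply, hLD, smul_eq_mul, smul_eq_mul]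
  ring

/-! ## §4 THE ORDER-TWO WILSON MEMBER of `a2` (twin of `PeriodisedWardOrderTwoWilson.torus_a2_wilson`; #21's `hW₀ hW₁ hW₂` VERBATIM, `2 ≤ N`, `G := 0`) -/

/-- **[folklore] `sum_perZ_dper_wilsonT2per_mul_towerGen`** — §1 at `PeriodisedFormGaugeLegTwo.sum_perZ_dper_wilsonT2per_mul_grad_periodic`: the periodised
Wilson bi-family `V κ u = Σ'_m W₂(… κ u κ′ (u′ + T·m) …)` (index bonds `(κ, u)`, `(κ′, u′)` in the finest box) against any nested mode `e` — the mode's potential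
read at the tips of the two index bonds (`−½`), the diagonal contact (`−¼`) and the first-leg contact (`⅛`), against the first-order members and the level-0 form block. -/
theorem sum_perZ_dper_wilsonT2per_mul_towerGen {N : ℕ} (hN : 2 ≤ N) (n : ℕ) (M : Fin (d + 1) → ℕ) [∀ μ, NeZero (M μ)] (rs : ℕ → (Fin (d + 1) → ℕ))
    (κ' : Fin (d + 1)) {u' : Site (d + 1)} (hu' : u' ∈ pbox (towerTorus Lc M n))
    {V : Fin (d + 1) → Site (d + 1) → MKer (d + 1) (Fib d)}
    (hV : V = fun κ u x z a c => ∑' m : Site (d + 1), wilsonW₂ d ((8 * (N : ℝ) ^ 2)⁻¹ • wsym22 N) κ u κ' (translate (towerTorus Lc M n) u' m) x z a c)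
    (ρ : Site (d + 1)) (L : ℕ) [NeZero L] (κ : Fin (d + 1)) {u : Site (d + 1)} (hu : u ∈ pbox (towerTorus Lc M n)) {x : Site (d + 1)}
    (hx : x ∈ pbox (towerTorus Lc M n)) (α : Fin (d + 1)) (e : NParam Lc M rs n) :
    ∑ y : ↥(pbox (towerTorus Lc M n)), ∑ β : Fin (d + 1),
        perZ (towerTorus Lc M n) (dper (towerTorus Lc M n) (V κ u)) x (y : Site (d + 1)) (Sum.inl α) (Sum.inl β) * towerGen Lc M rs n (y, β) e
      = -(1 / 2 : ℝ) * (evalN Lc M rs n (fun z : Site (d + 1) => z) (u' + unitVec κ') e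
              * perZ (towerTorus Lc M n) (dper (towerTorus Lc M n) (wilsonA d κ u)) x u' (Sum.inl α) (Sum.inl κ')
            + evalN Lc M rs n (fun z : Site (d + 1) => z) (u + unitVec κ) e
              * perZ (towerTorus Lc M n) (dper (towerTorus Lc M n) (wilsonA d κ' u')) x u (Sum.inl α) (Sum.inl κ))
        - (1 / 4 : ℝ) * ((if u = u' ∧ κ = κ' then (1 : ℝ) else 0) * evalN Lc M rs n (fun z : Site (d + 1) => z) (u + unitVec κ) e
            * perZ (towerTorus Lc M n) (bhKStepAt d ρ L 0) x u (Sum.inl α) (Sum.inl κ))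
        + (1 / 8 : ℝ) * evalN Lc M rs n (fun z : Site (d + 1) => z) (x + unitVec α) e
            * ((if x = u' ∧ α = κ' then (1 : ℝ) else 0) * perZ (towerTorus Lc M n) (bhKStepAt d ρ L 0) x u (Sum.inl α) (Sum.inl κ)
              + (if x = u ∧ α = κ then (1 : ℝ) else 0) * perZ (towerTorus Lc M n) (bhKStepAt d ρ L 0) x u' (Sum.inl α) (Sum.inl κ')) :=
  sum_perZ_mul_towerGen_of_grad_law Lc x α n M rs (dper (towerTorus Lc M n) (V κ u))
    (fun φ : Site (d + 1) → ℝ =>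
      -(1 / 2 : ℝ) * (φ (u' + unitVec κ') * perZ (towerTorus Lc M n) (dper (towerTorus Lc M n) (wilsonA d κ u)) x u' (Sum.inl α) (Sum.inl κ')
            + φ (u + unitVec κ) * perZ (towerTorus Lc M n) (dper (towerTorus Lc M n) (wilsonA d κ' u')) x u (Sum.inl α) (Sum.inl κ))
        - (1 / 4 : ℝ) * ((if u = u' ∧ κ = κ' then (1 : ℝ) else 0) * φ (u + unitVec κ) * perZ (towerTorus Lc M n) (bhKStepAt d ρ L 0) x u (Sum.inl α) (Sum.inl κ))
        + (1 / 8 : ℝ) * φ (x + unitVec α)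
            * ((if x = u' ∧ α = κ' then (1 : ℝ) else 0) * perZ (towerTorus Lc M n) (bhKStepAt d ρ L 0) x u (Sum.inl α) (Sum.inl κ)
              + (if x = u ∧ α = κ then (1 : ℝ) else 0) * perZ (towerTorus Lc M n) (bhKStepAt d ρ L 0) x u' (Sum.inl α) (Sum.inl κ')))
    (fun _ hφ => sum_perZ_dper_wilsonT2per_mul_grad_periodic (towerTorus Lc M n) hN κ' hu' hV ρ L κ hu hx α hφ) e

/-- **[folklore] `torus_a2_wilson_tower` — THE WILSON SECTOR OF THE TOWER's `a2` ROW IN CLOSED FORM** (#21 ∕ #21-Sym's `hW₀ hW₁ hW₂` at depth `n`, an2's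
`hW` VERBATIM on the finest torus; `2 ≤ N`): on `T = towerTorus Lc M′ n`, for any bond weight `h`,
`H₂ʷ * W₀ + 2 • (H₁ʷ * W₁) + H₀ * W₂ = c² • of (v e ↦ h v · (H₀ *ᵥ h) v · ψ_e(v.1 + e_{v.2}))`,
`H₁ʷ := (−2c) • Σ_b h b • (perF T (dper T (wilsonA d b)))|ff`, `H₂ʷ := (−2c)² • Σ_b Σ_b′ (h b·h b′) • (perF T (dper T (W b′ b)))|ff` — by §4's letter per pair of
bonds and `PeriodisedWardOrderTwoWilson.a2_row_algebra`: the `−½` tip readings of the bi-member are exactly `−2 • (H₁ʷ * W₁)`, its `−¼` diagonal contact is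
exactly `−H₀ * W₂`, and the `⅛` first-leg contact survives — DIAGONAL in the fluctuation bond, proportional to the linearised-KKT residual `H₀ h`
(`torus_a2_wilson` at every storey; `a2`'s Wilson sector is `𝔔₀ᵀ·Y₂`-shaped for no `Y₂` in general). -/
theorem torus_a2_wilson_tower (M' : Fin (d + 1) → ℕ) [∀ μ, NeZero (M' μ)] (rs : ℕ → (Fin (d + 1) → ℕ)) (n : ℕ) (ρ : Site (d + 1)) (L : ℕ) [NeZero L]
    (c : ℝ) (h : ↥(pbox (towerTorus Lc M' n)) × Fin (d + 1) → ℝ)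
    {H₀ : Matrix (↥(pbox (towerTorus Lc M' n)) × Fin (d + 1)) (↥(pbox (towerTorus Lc M' n)) × Fin (d + 1)) ℝ}
    (hH₀ : H₀ = (perF (towerTorus Lc M' n) (bhKStepAt d ρ L 0)).submatrix
        (fun b : ↥(pbox (towerTorus Lc M' n)) × Fin (d + 1) => ((b.1, Sum.inl b.2) : Idx (towerTorus Lc M' n) (Fib d)))
        (fun b : ↥(pbox (towerTorus Lc M' n)) × Fin (d + 1) => ((b.1, Sum.inl b.2) : Idx (towerTorus Lc M' n) (Fib d))))
    {W₀ : Matrix (↥(pbox (towerTorus Lc M' n)) × Fin (d + 1)) (NParam Lc M' rs n) ℝ} (hW₀ : W₀ = towerGen Lc M' rs n)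
    {W₁ : Matrix (↥(pbox (towerTorus Lc M' n)) × Fin (d + 1)) (NParam Lc M' rs n) ℝ}
    (hW₁ : W₁ = Matrix.of fun (b : (↥(pbox (towerTorus Lc M' n)) × Fin (d + 1))) (e : NParam Lc M' rs n) =>
        -(c * h b * evalN Lc M' rs n (fun b' : (↥(pbox (towerTorus Lc M' n)) × Fin (d + 1)) => (b'.1 : Site (d + 1)) + unitVec b'.2) b e))
    {W₂ : Matrix (↥(pbox (towerTorus Lc M' n)) × Fin (d + 1)) (NParam Lc M' rs n) ℝ}
    (hW₂ : W₂ = Matrix.of fun (b : (↥(pbox (towerTorus Lc M' n)) × Fin (d + 1))) (e : NParam Lc M' rs n) =>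
        (c * h b) ^ 2 * evalN Lc M' rs n (fun b' : (↥(pbox (towerTorus Lc M' n)) × Fin (d + 1)) => (b'.1 : Site (d + 1)) + unitVec b'.2) b e)
    {H₁ : Matrix (↥(pbox (towerTorus Lc M' n)) × Fin (d + 1)) (↥(pbox (towerTorus Lc M' n)) × Fin (d + 1)) ℝ}
    (hH₁ : H₁ = ((-2 : ℝ) * c) • ∑ b : ↥(pbox (towerTorus Lc M' n)) × Fin (d + 1), h b •
        (perF (towerTorus Lc M' n) (dper (towerTorus Lc M' n) (wilsonA d b.2 (b.1 : Site (d + 1))))).submatrix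
          (fun b : ↥(pbox (towerTorus Lc M' n)) × Fin (d + 1) => ((b.1, Sum.inl b.2) : Idx (towerTorus Lc M' n) (Fib d)))
          (fun b : ↥(pbox (towerTorus Lc M' n)) × Fin (d + 1) => ((b.1, Sum.inl b.2) : Idx (towerTorus Lc M' n) (Fib d))))
    {N : ℕ} (hN : 2 ≤ N)
    {W : Fin (d + 1) → Site (d + 1) → Fin (d + 1) → Site (d + 1) → MKer (d + 1) (Fib d)}
    (hW : W = fun κ' u' κ u x z a c =>
      ∑' m : Site (d + 1), wilsonW₂ d ((8 * (N : ℝ) ^ 2)⁻¹ • wsym22 N) κ u κ' (translate (towerTorus Lc M' n) u' m) x z a c)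
    {H₂ : Matrix (↥(pbox (towerTorus Lc M' n)) × Fin (d + 1)) (↥(pbox (towerTorus Lc M' n)) × Fin (d + 1)) ℝ}
    (hH₂ : H₂ = ((-2 : ℝ) * c) ^ 2 •
        ∑ b : ↥(pbox (towerTorus Lc M' n)) × Fin (d + 1), ∑ b' : ↥(pbox (towerTorus Lc M' n)) × Fin (d + 1), (h b * h b') •
          (perF (towerTorus Lc M' n) (dper (towerTorus Lc M' n) (W b'.2 (b'.1 : Site (d + 1)) b.2 (b.1 : Site (d + 1))))).submatrix
            (fun c : ↥(pbox (towerTorus Lc M' n)) × Fin (d + 1) => ((c.1, Sum.inl c.2) : Idx (towerTorus Lc M' n) (Fib d)))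
            (fun c : ↥(pbox (towerTorus Lc M' n)) × Fin (d + 1) => ((c.1, Sum.inl c.2) : Idx (towerTorus Lc M' n) (Fib d)))) :
    H₂ * W₀ + (2 : ℝ) • (H₁ * W₁) + H₀ * W₂
      = c ^ 2 • Matrix.of (fun (v : ↥(pbox (towerTorus Lc M' n)) × Fin (d + 1)) (e : NParam Lc M' rs n) =>
          h v * H₀.mulVec h v * evalN Lc M' rs n (fun z : Site (d + 1) => z) ((v.1 : Site (d + 1)) + unitVec v.2) e) := by
  classical
  -- entries of the ingredients
  have hev : ∀ (b : ↥(pbox (towerTorus Lc M' n)) × Fin (d + 1)) (e : NParam Lc M' rs n),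
      evalN Lc M' rs n (fun b' : (↥(pbox (towerTorus Lc M' n)) × Fin (d + 1)) => (b'.1 : Site (d + 1)) + unitVec b'.2) b e
        = evalN Lc M' rs n (fun z : Site (d + 1) => z) ((b.1 : Site (d + 1)) + unitVec b.2) e := fun b e =>
    evalN_apply_eq Lc (fun b' : (↥(pbox (towerTorus Lc M' n)) × Fin (d + 1)) => (b'.1 : Site (d + 1)) + unitVec b'.2) b n M' rs e
  have hH0 : ∀ v b : ↥(pbox (towerTorus Lc M' n)) × Fin (d + 1),
      H₀ v b = perZ (towerTorus Lc M' n) (bhKStepAt d ρ L 0) (v.1 : Site (d + 1)) (b.1 : Site (d + 1)) (Sum.inl v.2) (Sum.inl b.2) := fun v b => by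
    rw [hH₀]; rfl
  have hW1 : ∀ (b' : ↥(pbox (towerTorus Lc M' n)) × Fin (d + 1)) (e : NParam Lc M' rs n),
      W₁ b' e = h b' * (-c * evalN Lc M' rs n (fun z : Site (d + 1) => z) ((b'.1 : Site (d + 1)) + unitVec b'.2) e) := fun b' e => by
    rw [hW₁, Matrix.of_apply, hev]; ring
  have hW2 : ∀ (b : ↥(pbox (towerTorus Lc M' n)) × Fin (d + 1)) (e : NParam Lc M' rs n),
      W₂ b e = (c * h b) ^ 2 * evalN Lc M' rs n (fun z : Site (d + 1) => z) ((b.1 : Site (d + 1)) + unitVec b.2) e := fun b e => by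
    rw [hW₂, Matrix.of_apply, hev]
  have hH1 : ∀ v b' : ↥(pbox (towerTorus Lc M' n)) × Fin (d + 1), H₁ v b' = (-2 * c) * ∑ b : ↥(pbox (towerTorus Lc M' n)) × Fin (d + 1),
      h b * perZ (towerTorus Lc M' n) (dper (towerTorus Lc M' n) (wilsonA d b.2 (b.1 : Site (d + 1)))) (v.1 : Site (d + 1)) (b'.1 : Site (d + 1))
        (Sum.inl v.2) (Sum.inl b'.2) := fun v b' => by
    rw [hH₁, Matrix.smul_apply, Matrix.sum_apply, smul_eq_mul]
    simp only [Matrix.smul_apply, Matrix.submatrix_apply, perF_apply, smul_eq_mul]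
  have hWV : ∀ (κ' : Fin (d + 1)) (u' : Site (d + 1)), W κ' u' = fun κ u x z a c =>
      ∑' m : Site (d + 1), wilsonW₂ d ((8 * (N : ℝ) ^ 2)⁻¹ • wsym22 N) κ u κ' (translate (towerTorus Lc M' n) u' m) x z a c := fun κ' u' => by rw [hW]
  have hind : ∀ b b' : ↥(pbox (towerTorus Lc M' n)) × Fin (d + 1),
      (if (b.1 : Site (d + 1)) = (b'.1 : Site (d + 1)) ∧ b.2 = b'.2 then (1 : ℝ) else 0) = if b = b' then (1 : ℝ) else 0 := by
    intro b b'
    by_cases hb : b = b'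
    · rw [if_pos hb, if_pos ⟨by rw [hb], by rw [hb]⟩]
    · rw [if_neg hb, if_neg fun h' => hb (Prod.ext (Subtype.ext h'.1) h'.2)]
  -- the bi-member block against the tower's generators: §4's letter per pair of bonds
  have hVD : ∀ (b b' v : ↥(pbox (towerTorus Lc M' n)) × Fin (d + 1)) (e : NParam Lc M' rs n),
      ((perF (towerTorus Lc M' n) (dper (towerTorus Lc M' n) (W b'.2 (b'.1 : Site (d + 1)) b.2 (b.1 : Site (d + 1))))).submatrix
            (fun c : ↥(pbox (towerTorus Lc M' n)) × Fin (d + 1) => ((c.1, Sum.inl c.2) : Idx (towerTorus Lc M' n) (Fib d)))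
            (fun c : ↥(pbox (towerTorus Lc M' n)) × Fin (d + 1) => ((c.1, Sum.inl c.2) : Idx (towerTorus Lc M' n) (Fib d))) * W₀) v e
        = -(1 / 2 : ℝ) * (evalN Lc M' rs n (fun z : Site (d + 1) => z) ((b'.1 : Site (d + 1)) + unitVec b'.2) e
              * perZ (towerTorus Lc M' n) (dper (towerTorus Lc M' n) (wilsonA d b.2 (b.1 : Site (d + 1)))) (v.1 : Site (d + 1)) (b'.1 : Site (d + 1))
                  (Sum.inl v.2) (Sum.inl b'.2)
            + evalN Lc M' rs n (fun z : Site (d + 1) => z) ((b.1 : Site (d + 1)) + unitVec b.2) e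
              * perZ (towerTorus Lc M' n) (dper (towerTorus Lc M' n) (wilsonA d b'.2 (b'.1 : Site (d + 1)))) (v.1 : Site (d + 1)) (b.1 : Site (d + 1))
                  (Sum.inl v.2) (Sum.inl b.2))
          - (1 / 4 : ℝ) * ((if b = b' then (1 : ℝ) else 0) * evalN Lc M' rs n (fun z : Site (d + 1) => z) ((b.1 : Site (d + 1)) + unitVec b.2) e
              * perZ (towerTorus Lc M' n) (bhKStepAt d ρ L 0) (v.1 : Site (d + 1)) (b.1 : Site (d + 1)) (Sum.inl v.2) (Sum.inl b.2))
          + (1 / 8 : ℝ) * evalN Lc M' rs n (fun z : Site (d + 1) => z) ((v.1 : Site (d + 1)) + unitVec v.2) e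
              * ((if v = b' then (1 : ℝ) else 0) * perZ (towerTorus Lc M' n) (bhKStepAt d ρ L 0) (v.1 : Site (d + 1)) (b.1 : Site (d + 1)) (Sum.inl v.2) (Sum.inl b.2)
                + (if v = b then (1 : ℝ) else 0)
                  * perZ (towerTorus Lc M' n) (bhKStepAt d ρ L 0) (v.1 : Site (d + 1)) (b'.1 : Site (d + 1)) (Sum.inl v.2) (Sum.inl b'.2)) := by
    intro b b' v e
    rw [hW₀, Matrix.mul_apply, Fintype.sum_prod_type]
    simp only [Matrix.submatrix_apply, perF_apply]
    rw [sum_perZ_dper_wilsonT2per_mul_towerGen Lc hN n M' rs b'.2 b'.1.2 (hWV b'.2 b'.1) ρ L b.2 b.1.2 v.1.2 v.2 e]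
    simp only [hind]
  -- the order-two product, entrywise, as a double bond sum
  have hH2D : ∀ (v : ↥(pbox (towerTorus Lc M' n)) × Fin (d + 1)) (e : NParam Lc M' rs n),
      (H₂ * W₀) v e = (-2 * c) ^ 2 * ∑ b : ↥(pbox (towerTorus Lc M' n)) × Fin (d + 1), ∑ b' : ↥(pbox (towerTorus Lc M' n)) × Fin (d + 1), h b * h b' *
        ((perF (towerTorus Lc M' n) (dper (towerTorus Lc M' n) (W b'.2 (b'.1 : Site (d + 1)) b.2 (b.1 : Site (d + 1))))).submatrix
            (fun c : ↥(pbox (towerTorus Lc M' n)) × Fin (d + 1) => ((c.1, Sum.inl c.2) : Idx (towerTorus Lc M' n) (Fib d)))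
            (fun c : ↥(pbox (towerTorus Lc M' n)) × Fin (d + 1) => ((c.1, Sum.inl c.2) : Idx (towerTorus Lc M' n) (Fib d))) * W₀) v e := by
    intro v e
    rw [hH₂, Matrix.smul_mul, Matrix.sum_mul, Matrix.smul_apply, Matrix.sum_apply, smul_eq_mul]
    refine congrArg _ (Finset.sum_congr rfl fun b _ => ?_)
    rw [Matrix.sum_mul, Matrix.sum_apply]
    refine Finset.sum_congr rfl fun b' _ => ?_
    rw [Matrix.smul_mul, Matrix.smul_apply, smul_eq_mul]
  ext v e
  rw [Matrix.add_apply, Matrix.add_apply, Matrix.smul_apply, Matrix.smul_apply, Matrix.of_apply, smul_eq_mul, smul_eq_mul, hH2D v e,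
    Matrix.mul_apply, Matrix.mul_apply]
  simp only [hW1, hW2, hH1, Matrix.mulVec, dotProduct, hH0]
  simp only [hVD]
  exact a2_row_algebra c h (fun b => evalN Lc M' rs n (fun z : Site (d + 1) => z) ((b.1 : Site (d + 1)) + unitVec b.2) e)
    (fun b => perZ (towerTorus Lc M' n) (bhKStepAt d ρ L 0) (v.1 : Site (d + 1)) (b.1 : Site (d + 1)) (Sum.inl v.2) (Sum.inl b.2))
    (fun b b' => perZ (towerTorus Lc M' n) (dper (towerTorus Lc M' n) (wilsonA d b.2 (b.1 : Site (d + 1)))) (v.1 : Site (d + 1)) (b'.1 : Site (d + 1))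
      (Sum.inl v.2) (Sum.inl b'.2)) v

end Summit.QuantumFields.BalabanUV.Beta.FP.PeriodisedWardOrderOneTower

end
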